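import Literature.Analysis.Complex.OsgoodProofs
import Mathlib.Analysis.Calculus.ImplicitContDiff
import HarnessLib

/-!
# The holomorphic implicit function theorem for a plane curve germ `G(α, β) = 0`, with a uniqueness box

Local complex analysis (E. M. Chirka, *Complex Analytic Sets* (1989), §1.2: the implicit function theorem in the
holomorphic category).  Written by the prover seat `hodge-nonav-prover-Bx` (g12, cell `hodge-nonav`) for the
bifurcation analysis of the symmetric `A₃` point (programme B2-BIF,
`Literature/AlgebraicGeometry/HodgeTheory/SymmetricA3*`): the off-axis component `β = ψ(α)` of the bifurcation set is
the zero set of the critical value function `G`.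

* `SCV.exists_holomorphic_implicit` — for `G : ℂ × ℂ → ℂ` holomorphic on an open `V ∋ 0` with `G(0) = 0` and
  `∂_β G(0) ≠ 0` there are a function `ψ` holomorphic on `|α| < ε` with `ψ(0) = 0`, and `δ > 0`, such that for
  `|α| < ε`, `|β| < δ`: `(α, β) ∈ V`, `|ψ(α)| < δ`, and `G(α, β) = 0 ↔ β = ψ(α)` (Mathlib's
  `ContDiffAt.implicitFunction` in smoothness `ω`, packaged with explicit radii).

## References
* [Chirka1989] E. M. Chirka, *Complex Analytic Sets*, Kluwer 1989, §1.2.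
-/

noncomputable section

open Metric Set Filter
open scoped Topology ContDiff

namespace Literature.Analysis.Complex
namespace SCV

/-- **Holomorphic implicit function theorem with a uniqueness box.**  Let `G : ℂ × ℂ → ℂ` be holomorphic on an open
set `V ∋ 0` with `G(0) = 0` and `∂_β G(0) = dG(0)(0, 1) ≠ 0`.  Then there are `ψ : ℂ → ℂ` and `ε, δ > 0` with `ψ`
holomorphic on `|α| < ε`, `ψ(0) = 0`, and for all `|α| < ε`, `|β| < δ`: `(α, β) ∈ V`, `|ψ(α)| < δ` and
`G(α, β) = 0 ↔ β = ψ(α)`. [cite: Chirka1989, §1.2] -/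
theorem exists_holomorphic_implicit {G : ℂ × ℂ → ℂ} {V : Set (ℂ × ℂ)} (hV : IsOpen V) (h0 : (0 : ℂ × ℂ) ∈ V)
    (hG : DifferentiableOn ℂ G V) (hG0 : G 0 = 0) (hβ : fderiv ℂ G 0 (0, 1) ≠ 0) :
    ∃ (ψ : ℂ → ℂ) (ε δ : ℝ), 0 < ε ∧ 0 < δ ∧ DifferentiableOn ℂ ψ (ball (0 : ℂ) ε) ∧ ψ 0 = 0 ∧
      (∀ α ∈ ball (0 : ℂ) ε, ‖ψ α‖ < δ) ∧
      (∀ α ∈ ball (0 : ℂ) ε, ∀ β ∈ ball (0 : ℂ) δ, (α, β) ∈ V ∧ (G (α, β) = 0 ↔ β = ψ α)) := by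
  -- smoothness `ω` at the origin and invertibility of the `β`-partial
  have cdf : ContDiffAt ℂ ω G (0 : ℂ × ℂ) :=
    (analyticAt_of_differentiableOn hG hV h0).contDiffAt
  set c : ℂ := fderiv ℂ G 0 (0, 1) with hc
  have hinr : fderiv ℂ G (0 : ℂ × ℂ) ∘L ContinuousLinearMap.inr ℂ ℂ ℂ =
      ((ContinuousLinearEquiv.unitsEquivAut ℂ (Units.mk0 c hβ) : ℂ ≃L[ℂ] ℂ) : ℂ →L[ℂ] ℂ) := by
    ext
    simp [hc]
  have if₂ : (fderiv ℂ G (0 : ℂ × ℂ) ∘L ContinuousLinearMap.inr ℂ ℂ ℂ).IsInvertible := by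
    rw [hinr]; exact ⟨_, rfl⟩
  have hω : (ω : ℕ∞ω) ≠ 0 := by simp
  set ψ : ℂ → ℂ := cdf.implicitFunction hω if₂ with hψ
  have hψ0 : ψ 0 = 0 := cdf.implicitFunction_apply_self hω if₂
  have hψa : AnalyticAt ℂ ψ 0 := (cdf.contDiffAt_implicitFunction hω if₂).analyticAt
  have hiff : ∀ᶠ v in 𝓝 (0 : ℂ × ℂ), G v = G 0 ↔ ψ v.1 = v.2 :=
    cdf.eventually_apply_eq_iff_implicitFunction hω if₂
  -- a product box inside `V` on which the equivalence holds
  obtain ⟨δ, hδ, hbox⟩ : ∃ δ > 0, ball (0 : ℂ) δ ×ˢ ball (0 : ℂ) δ ⊆ {v | (G v = G 0 ↔ ψ v.1 = v.2)} ∩ V := by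
    have hmem : {v : ℂ × ℂ | (G v = G 0 ↔ ψ v.1 = v.2)} ∩ V ∈ 𝓝 (0 : ℂ × ℂ) :=
      inter_mem hiff (hV.mem_nhds h0)
    obtain ⟨δ, hδ, hsub⟩ := Metric.mem_nhds_iff.1 hmem
    refine ⟨δ, hδ, fun v hv => hsub ?_⟩
    rw [← ball_prod_same]
    exact hv
  -- a disc on which `ψ` is holomorphic and small
  obtain ⟨ε₁, hε₁, hψon⟩ := hψa.exists_ball_analyticOnNhd
  have hsmall : ∀ᶠ α in 𝓝 (0 : ℂ), ‖ψ α‖ < δ := by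
    have h1 : ∀ᶠ α in 𝓝 (0 : ℂ), ψ α ∈ ball (0 : ℂ) δ :=
      hψa.continuousAt.preimage_mem_nhds (by rw [hψ0]; exact ball_mem_nhds _ hδ)
    exact h1.mono fun α hα => by simpa using hα
  obtain ⟨ε₂, hε₂, hε₂sub⟩ := Metric.mem_nhds_iff.1 hsmall
  set ε : ℝ := min (min ε₁ ε₂) δ with hεdef
  have hε : 0 < ε := lt_min (lt_min hε₁ hε₂) hδ
  have hεε₁ : ε ≤ ε₁ := (min_le_left _ _).trans (min_le_left _ _)
  have hεε₂ : ε ≤ ε₂ := (min_le_left _ _).trans (min_le_right _ _)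
  have hεδ : ε ≤ δ := min_le_right _ _
  refine ⟨ψ, ε, δ, hε, hδ, (hψon.mono (ball_subset_ball hεε₁)).differentiableOn, hψ0,
    fun α hα => hε₂sub (ball_subset_ball hεε₂ hα), fun α hα β hβ' => ?_⟩
  have hv : ((α, β) : ℂ × ℂ) ∈ ball (0 : ℂ) δ ×ˢ ball (0 : ℂ) δ := ⟨ball_subset_ball hεδ hα, hβ'⟩
  obtain ⟨h1, h2⟩ := hbox hv
  refine ⟨h2, ?_⟩
  change (G (α, β) = G 0 ↔ ψ α = β) at h1
  rw [hG0] at h1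
  rw [h1]
  exact eq_comm

end SCV
end Literature.Analysis.Complex

end
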